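/-
Copyright (c) 2026. All rights reserved.
Released under Apache 2.0 license as described in the file LICENSE.
Authors: abc-iut cell, statement-typer seat abc-iut-L4-t3 (wave 1; gen 9), owner of the §5 interface.
-/
import Literature.AnabelianGeometry.AbsoluteAnabelian.Ltimes.LogFrobeniusCorollaries
import Literature.AnabelianGeometry.AbsoluteAnabelian.LogFrobeniusMonoBaseFacts
import HarnessLib

/-!
# [AbsTopIII] Cor 5.10 (iv)(a): the bookkeeping of `D•⊢_{≤n-1} ∪ D•_{≤n}` (`monoBase`) — `⋉`-twin (aliases only)

S. Mochizuki, *Topics in absolute anabelian geometry III*, J. Math. Sci. Univ. Tokyo 22 (2015) [MochizukiAbsTopIII2015];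
manuscript `paper:url-5493eb38cbb7`, Cor 5.10 (iv)(a) p. 147 ("for `n = 5, 6, 7`, `D•⊢_{≤n}` admits a natural structure of
core on the subdiagram of categories of `D•⊢` determined by the union `D•⊢_{≤n-1} ∪ D•_{≤n}`").

**`⋉`-TWIN (cell row «LTIMES-SUCCESSOR», L4-lead m162; typing finding T3g9-F1; recipe `LTIMES-RECIPE.md`, slice T4b).**  The
frozen file `LogFrobeniusMonoBaseFacts.lean` (abc-iut-f-101) is ENTIRELY setting-independent — twenty-two facts about the
predicate `monoBase n` on the vertices of `D•⊢` — so its twin over the successor interface `LogFrobeniusSettingLtimes` declares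
NOTHING: it re-exposes those facts under the successor's namespace by `export` (aliases, not declarations), so that the verbatim
re-elaborations of the later Cor 5.10 (iv) files find them by their short names.  The successor's own copy of the predicate,
`LogFrobeniusSettingLtimes.monoBase` (slice T1), is definitionally the frozen `LogFrobeniusSetting.monoBase` (same body), so the
aliased facts apply to it on the nose.  A successor of OUR typing, print unchanged; nothing here bears on [IUTchIII] Cor. 3.12; no
side taken; typed ≠ proved.
-/

set_option autoImplicit false

namespace Literature.AnabelianGeometry.AbsoluteAnabelian

namespace LogFrobeniusSettingLtimes

export LogFrobeniusSetting (not_forall_monoBase not_monoBase_zero monoBase_of_isHolomorphic monoBase_of_not_isHolomorphic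
  row_le_of_monoBase row_le_pred_of_monoBase monoBase_mono monoBase_of_inFirstRows monoBase_six_row1 monoBase_six_core
  monoBase_six_nplus monoBase_six_nv monoBase_six_e5 monoBase_six_an monoBase_six_nmonoPlus monoBase_six_nmono
  monoBase_six_emono5 monoBase_six_telecorePaths not_monoBase_six_anMono not_monoBase_six_e7 not_monoBase_six_emono7
  monoBase_six_iff)

/-- The successor's `monoBase` (slice T1's verbatim copy) IS the frozen predicate, so every aliased fact above applies to it.
[cite: MochizukiAbsTopIII2015, Cor 5.10 (iv)(a) p. 147] -/
theorem monoBase_eq_frozen {Vmod : Type*} {isArc : Vmod → Bool} (n : ℕ) (x : DVertex Vmod isArc) :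
    LogFrobeniusSettingLtimes.monoBase n x = LogFrobeniusSetting.monoBase n x := rfl

end LogFrobeniusSettingLtimes

end Literature.AnabelianGeometry.AbsoluteAnabelian
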